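import Summits.QuantumFields.YangMills.Theorems.BalabanLadderIRAbstractBasinRung24
import HarnessLib

/-!
REV 8: FOURTH GROUP-FREE RUNG LANDED — `Theorems/BalabanLadderIRAbstractBasinRung24.lean` (p604479, 4ce672ceda68): Hölder one-box API (`exc_add_le_mul`,
`exc_add_le_of_pow_le`, `exc_three_mul_le_cube`, `exc_le_refined`) + the quadrupling `L → 4L` with extension at time `3t`: `abstractBasin_24 : AbstractBasin (1/24) (1/2^6)`,
`IR_of_exitAt24 : ColdExitAt (1/24) → AFToColdPressure → IRnsc → IR` (seed = ONE ≥ 95.8 %-pure cold torus per β, ≈ 35a at β_W 2.4).  The squaring/extension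
bookkeeping family is now at its optimum (entry ≈ 1/22); the abstract stub is re-targeted to the PROVED entry: `stub_abstractBasin36 : AbstractBasin (1/2^3) (1/24)`
(window ×3; BC7 CLEAN `Idea9Probe8`); `IR_of : AbstractBasin (1/8) (1/24) → ColdExitAt (1/8) → AFToColdPressure → IRnsc → IR`.
REV 7: THE RANK-2 STUB OF REV 4–6 IS A TREE THEOREM — `Theorems/BalabanLadderIRAbstractBasinRung6.lean` (p603750, this seat, commit 3ccd62da7b7e):
`abstractBasin_two_pow_6 : AbstractBasin (1/2^6) (1/2^8)` (square in time FIRST on the small cube, extend at the long time `c = 2t` with `cube_extension_sharp`: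
the volume-law map `δ(2L) ≤ 37 u²`, entry `≈ 1/39`), `IR_of_exitAt6 : ColdExitAt (1/2^6) → AFToColdPressure → IRnsc → IR`.  The threshold-raising lever has now
moved the seed of the bill from `2⁻²⁴` to `2⁻⁶` (factor `2¹⁸`) by group-free theorems.  NEXT RUNG (this rev): `stub_abstractBasin36 : AbstractBasin (1/2^3) (1/2^6)`
(rank 2, group-free; beyond the reach of squaring bookkeeping, whose entry is `≈ 1/39` and whose hard ceiling is `1/2`: needs a NEW input — idea
«modular-moment») + `stub_seed8 : ColdExitAt (1/2^3)` (rank 3: ONE ≥ 87.5 %-pure cold `4:1` torus per β; SU(2) β_W = 2.4 witness `≈ 32a ≈ 3.8 fm`, inside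
standard ensembles — the line's located half becomes DIRECTLY INSTRUMENTABLE).  `IR_of : AbstractBasin (1/8) (1/64) → ColdExitAt (1/8) → AFToColdPressure → IRnsc → IR`.
REV 6: the sharp-extension rung LANDED too — `Theorems/BalabanLadderIRAbstractBasinRung8.lean` (p603051, this seat; `cube_extension_sharp` of
ym-ir-idea-13 + `exc_le_sharp`): `abstractBasin_two_pow_8 : AbstractBasin (1/2^8) (1/2^9)`, `abstractBasin_two_pow_8_epsStar`, `IR_of_exitAt8`.  The abstract
stub is RE-TUNED to the proved basin entry: `stub_abstractBasin64 : AbstractBasin (1/2^6) (1/2^8)` (open window ×4: 2⁻⁶ → 2⁻⁸); seed of record 2⁻⁸ (≈ 48a).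
REV 5: rebased on the LANDED helper `Theorems/BalabanLadderIRAbstractBasinRung.lean` (p602096, commit c83f04b9e429; namespace `…Cruxes.IR.BasinRung`):
`ColdExitAt`, `AbstractBasin`, `epsStar`, `coldPressureOnsetSC_of_exitAt`, `IR_of_exitAt`, `exc_le_sharp`, `defectSquaring_double_sharp`, `abstractBasin_two_pow_9`,
`coldExitAt_of_abstractBasin`, `IR_of_exitAt9` are now TREE theorems and are imported, not restated; this workfile keeps only `BasinSC`, the stubs, the
cut bookkeeping and the composition.

# Line `basin-transfer` on crux `BalabanLadder.IR` (stmt-QuantumFields-19354, rung R2c) — seed E at ONE tolerance, cut by TOLERANCE: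
# an O(1)-tolerance one-scale purity `E(1/16)` (instrumentable, carries the group) + a basin-enlargement statement `Basin(1/16 → 2⁻²⁴)`

Cell ym-ir, IDEATOR seat ym-ir-idea-9 g0 (lens «transfer»: port from the nearest solved sibling with a located input; the first
non-transferring step is the crux).  Slot `Cruxes/IR/Lines/basin_transfer.lean` — an ALTERNATIVE line; the skeleton of record stays
`Cruxes/IR/Lines/af_pincer_Uc_sharp.lean`.  Card: `Lines/basin-transfer.md`.

HONEST FRAMING.  The Yang–Mills mass gap (Clay) is NOT proved by anything here.  R4 (`BalabanUVStability4`) closes only the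
conditional finite-𝕋⁴ rung `BalabanLadder.UV`.  This file is kernel bookkeeping of a CONDITIONAL reduction of ONE binder (`IR`) of
the ladder; sorries live ONLY in the four `stub_*`; 0 legs discharged.

THE SEED OF RECORD.  With R = `ColdDoublingRecursionSC` PROVED (`AspectBootstrap.coldDoublingRecursionSC_holds`, p596893) and its
explicit form `AspectBootstrap.coldDefect_sq_le_two_pow` (δᶜ_β(L') ≤ 2²⁰ δᶜ_β(L)² for EVERY compact G, β ≥ 0, L ≥ 8, L' ∈ [2L,4L]), the
doubling-bridge bill (line `doubling-bridge`, `ColdPurityBridge.IR_of_bridge`) needs E only at ONE tolerance: `ColdExitAt ε⋆`,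
ε⋆ = 1/(16·max 2²⁰ 2) = 2⁻²⁴ (`coldPressureOnsetSC_of_exitAt`, PROVED here: per (G, r, β ≥ max β₁ 0) one scale L ≥ 8 with
δᶜ_β(L) ≤ 2⁻²⁴ gives `ColdPressureAt r.ρ β L` by the tree seam `ColdPurityBridge.coldPressureAt_of_exit_recursion`).  In words:
per β, ONE cold 4:1 torus whose thermal state at temperature 4/L has second-Rényi purity ≥ 1 − 2⁻²⁴
(`Z(L³×2t)/Z(L³×t)² = tr ρ_t²`, `t = ⌊L/4⌋`).

THE TRANSFER (dictionary, solved sibling = finite-size criteria for spectral gaps of frustration-free quantum spin systems: Knabe 1988;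
Gosset–Mozgunov 2016 «local gap threshold»; Lemm–Mozgunov 2019; Lemm–Sandvik–Wang 2020 = the 2D AKLT gap on the hexagonal lattice, open
since 1988, settled by «a finite-size criterion tailor-made for the problem … if the gap of the 36-site cluster exceeds the threshold
(a²−2a+3)/(10+4a) ≈ 0.138 then gapped for all sizes» + ONE numerical verification `Δ_F(1.4) = 0.14599 > 0.138` [corpus:arxiv-1910.11810
pp. 2–5]; and its classical cousin Dobrushin–Kolafa–Shlosman 1985, the DS finite-volume uniqueness condition verified by computer on small
boxes [corpus:doi-10-1007-bf01208821]):
  Knabe/DS abstract criterion «local quantity beyond a threshold at ONE size ⇒ global gap»  ↦  R (PROVED; threshold 2⁻²⁴ in purity defect);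
  the threshold-RAISING step (Gosset–Mozgunov / Lemm / Anshu: improve the criterion until the threshold is met by a COMPUTABLE cluster)
      ↦  `stub_abstractBasin36 : AbstractBasin (1/2^3) (1/24)` — raise the basin of the ABSTRACT purity bootstrap from 1/24 (PROVED, tree, rev 8) to 1/8;
  the one-size certificate (DMRG on 36 sites / DKS's boxes)  ↦  `stub_seed8 : ColdExitAt (1/2^3)` — per β, ONE cold torus ≥ 7/8-pure (rev 7; rev 4–6: 63/64, now proved sufficient).
The FIRST NON-TRANSFERRING STEP is the threshold-raising: for frustration-free spin systems it is linear algebra on interaction weights;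
here the abstract bootstrap (`defectSquaring_exp`: δ' ≤ 2(432 δ e^{432δ})²) loses the factor 432 in the [RP-ext]/[Sym] combinatorics and
its basin is ~10⁻⁶, while genuine transfer-matrix families contract from δ ≈ 0.1 (2D Ising data: δ(2L)/δ(L)² ≤ 1.1, tree docstring of
`squaringConst`).  The SECOND non-transferring step is the certificate: the sibling verifies ONE finite cluster; here the seed is one
torus PER β for unboundedly many β (L(β) ~ 2 fm / a(β) grows like e^{β/(4b₀)}), so it is MC-instrumentable (second-Rényi purity of the
thermal state by ratio/replica estimators; or spectral bookkeeping from measured torelon and glueball energies) but not certifiable —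
and it is exactly where the gauge group enters: `U(1)₄` fails `E(1/16)` at every β ≥ 1.1 and every L (photon gas: δᶜ → 1 − e^{−24}),
`SU(2)₅` fails it (non-abelian Coulomb phase), Wilson `SU(2)₄` passes it at L ≈ 2 fm (torelons `3e^{−KL²/4}` and the glueball gas below
1/32).  So the cut obeys the census sieve B-GROUP-BLIND-LENS: the group-blind-compatible half (`BasinSC`, vacuously true for U(1)) is the
structural statement, the group-sensitive half (`E(1/16)`) is a NUMBER at one scale.

PROVED RUNG (§5, no sorry; rev 4): `abstractBasin_two_pow_9 : AbstractBasin (1/2^9) epsStar` — the basin of the abstract bootstrap already reaches 2⁻⁹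
(exact doubling + the sharp excess bound `exc_le_sharp`: linear constant 13.61 instead of 432; contraction below δ* ≈ 2^{−8.6}); hence `basinSC_two_pow_9`
and `IR_of_exitAt9 : ColdExitAt (1/2^9) → X → N → IR`: the SEED OF RECORD moves from 2⁻²⁴ (≈ 100a at β_W = 2.4) to 2⁻⁹ (≈ 50a) with no new hypothesis
(factor 2¹⁵ in tolerance); the open window of the basin stub is 2⁻⁶ → 2⁻⁹ (factor 8).

STUBS (rev 8, current): `stub_abstractBasin36 : AbstractBasin (1/2^3) (1/24)` (RANK 2, group-free, BC7 CLEAN probe8), `stub_seed8 : ColdExitAt (1/2^3)` (rank 3, located,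
BC7 CLEAN), `stub_afToColdPressure`, `stub_irnsc`.  HISTORY — STUBS (4; sorries only here; rev 4 — critic ym-ir-crit-3 PASS-WITH-PRICE P3/P4 + the proved rung §5): `stub_abstractBasin64 : AbstractBasin (1/2^6) (1/2^9)`
(crux, RANK 2 — the group-free threshold-raising over a window of a factor 8, the only non-circular door: the model form `BasinSC θ ε⋆` is the seed in
costume, `basinSC_of_coldExitAt` / `cut_iff_seed` §6), `stub_seed64 : ColdExitAt (1/2^6)` (crux, rank 3 — the located, instrumentable, per-β seed at
purity ≥ 63/64, SU(2): L ≈ 44a at β_W = 2.4; no prover per R366),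
`stub_afToColdPressure : AFToColdPressure` (X, tree, by name), `stub_irnsc : IRnsc` (N, tree residual of record, by name).  Composition `IR_of` /
`IR_of_stubs` (§6) kernel-checked, no sorry, through the PROVED rung `basinSC_two_pow_9`.

WHY IT MIGHT FAIL.  `BasinSC θ ε⋆` is FALSE for θ ≥ 1/2 even model-specifically at a first-order bulk point (two degenerate vacua:
δᶜ → 1/2 at all L) and abstractly for every θ ≥ 1/2 (top eigenvalue of multiplicity 2); for θ = 1/16 a counterexample needs a purity
PLATEAU of height in (2⁻²⁴, 1/16] — a scale-invariant thermal population of ~0.03 nats at aspect 4:1→4:2, i.e. a gapless sector with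
tiny effective central charge; for simply-connected simple G at large β no such sector is known (the only gapless candidate, the
non-abelian Coulomb phase, has δᶜ ≈ 1 − e^{−26(N²−1)}, far above 1/16, so it violates the HYPOTHESIS, not the implication).  Abstractly
(`AbstractBasin`) the «fast massless tower» (levels 2πv|n|/L, v ≫ 1, integer multiplicities) would be a plateau at 6e^{−πv/2} IF it were
realisable with axis symmetry [Sym] — the cheapest falsifier, a finite spectral-family search (card, INSTRUMENT row I9-3).
`ColdExitAt (1/16)` fails iff SU(N)-type theories have, at some large β, NO 15/16-pure cold torus at any L ≥ 8 — i.e. a massless or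
light-flux phase (it is false for U(1)₄, SO(3), SU(2)₅, finite G: exactly the census sieves).

Sources: Knabe1988 (J. Stat. Phys. 52, 627); GossetMozgunov2016 (doi:10.1063/1.4962337); LemmMozgunov2019 (arXiv:1801.08915);
Lemm2019 (arXiv:1902.07141); LemmSandvikWang2020 (arXiv:1910.11810); DobrushinKolafaShlosman1985 (doi:10.1007/BF01208821);
vandenBerg1993 (doi:10.1007/BF02097061); tree: `AspectBootstrap.coldDefect_sq_le_two_pow`, `defectSquaring_exp`, `squaringConst`,
`ColdPurityBridge.coldPressureAt_of_exit_recursion`, `ColdPressurePincer.IR_of_cp_repaired`; barriers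
`Literature.Barriers.QuantumFields.AbelianDeconfinementD4`, `…NonabelianCoulombPhaseD5`, `…MigdalKadanoffGroupBlindness`,
`…DiscreteSubgroupFreezing`.
-/

set_option autoImplicit false

noncomputable section

open MeasureTheory Filter Topology
open Literature.MathematicalPhysics.QuantumFieldTheory Literature.MathematicalPhysics.QuantumLattice
open Summit.QuantumFields.YangMills.Cruxes.IR.ColdPressurePincer
open Summit.QuantumFields.YangMills.Cruxes.IR.ColdPurityBridge
open Summit.QuantumFields.YangMills.Cruxes.IR.AspectBootstrap
open Summit.QuantumFields.YangMills.Cruxes.IR.BasinRung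

namespace Summit.QuantumFields.YangMills.Cruxes.IR.BasinTransfer

/-! ## §1 Statements (`ColdExitAt`, `AbstractBasin`, `epsStar` are the LANDED ones of `BasinRung`) -/

/-- **`BasinSC θ ε` — basin enlargement (model form).**  For every simply-connected compact simple `G` and `r`, eventually in `β`:
IF some cold torus of side `≥ 8` is `θ`-pure THEN some cold torus of side `≥ 8` is `ε`-pure.  («No purity plateau with height in
`(ε, θ]`.»)  Vacuously true for theories that are never `θ`-pure (U(1)₄): group-blind-compatible by design. -/
def BasinSC (θ ε : ℝ) : Prop :=
  ∀ (G : Type) [Group G] [TopologicalSpace G] [IsTopologicalGroup G] [CompactSpace G],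
    IsCompactSimpleLieGroup G → SimplyConnectedSpace G →
    letI : MeasurableSpace G := borel G; haveI : BorelSpace G := ⟨rfl⟩;
    ∀ r : LatticeRep G, ∃ β₁ : ℝ, ∀ β : ℝ, β₁ ≤ β →
      (∃ L : ℕ, 8 ≤ L ∧ coldDefect r.ρ β L ≤ θ) → ∃ L : ℕ, 8 ≤ L ∧ coldDefect r.ρ β L ≤ ε

/-! ## §2 The stubs (sorries ONLY here) -/

/-- **Stub 1 — the located seed `E(1/8)` (crux of the line, rank 3 — the located, instrumentable, per-β half; no prover per R366/(α)).**  Per β large,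
ONE cold `4:1` torus of side `≥ 8` whose thermal state at temperature `4/L` has second-Rényi purity defect `≤ 1/8` (SU(2), β_W = 2.4: glueball-gas synthesis puts
it at `L ≈ 32a ≈ 3.8 fm` — inside standard ensembles; rev 4–6 asked `2⁻⁶` at `≈ 42a`, which is now PROVED sufficient: `IR_of_exitAt6`).  Where the gauge group
enters (false for U(1)₄ / SU(2)₅ / SO(3) / finite G — light flux sectors give `δᶜ → 1 − 1/#sectors` or the photon gas `δᶜ ≈ 1 − e^{−19}`).  Why it might fail:
a massless or light-flux weak-coupling phase of some simply connected simple (G, r).  Sources: Luscher1983, vanBaal2001 (arXiv:hep-ph/0008206), BergBilloire1989,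
MichaelTeper1989; `Literature.Barriers.QuantumFields.AbelianDeconfinementD4`, `…NonabelianCoulombPhaseD5`. -/
theorem stub_seed8 : ColdExitAt (1 / 2 ^ 3) := by
  sorry

/-- **Stub 2 — ABSTRACT basin enlargement `AbstractBasin(1/8 → 1/24)` (crux, RANK 2 of the line; rev 8 — the rev 4–6 stub `AbstractBasin(2⁻⁶ → 2⁻⁸)` is
the tree theorem `abstractBasin_two_pow_6`, and `AbstractBasin (1/24) (2⁻⁶)` is `abstractBasin_24`).**  Raise the basin entry of the abstract purity bootstrap from the
PROVED `1/24` (true entry of the optimal squaring/extension bookkeeping `≈ 1/22`) to `1/8` in the class `[Sym]+[TM]+[Vol]`.  This is BEYOND squaring bookkeeping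
(entry `≈ 1/22`, hard ceiling `1/2` = two degenerate vacua): it needs a new use of `[Sym]` — the self-dual-point moment equations of idea «modular-moment» (2D toy decided: no conformal plateau below `1/4`).
Why it might fail: an IR-scale-invariant STIFF-AND-COLD member of the abstract class with plateau height in `(1/24, 1/8]` (torus gap `z₁ ≥ 4 ln 16 ≈ 11`, slab
Casimir interaction `≈ h/L`; non-local if it exists; none known — free massless data sit at `δ ≳ 0.7`, integer direct sums at `≥ 1/2`).  Sources: Shaghoulian
arXiv:1508.02728, Belin–de Boer–Kruthoff–Michel–Shaghoulian–Shyani arXiv:1610.06186, HKS arXiv:1405.5137, Hellerman arXiv:0902.2790; GossetMozgunov2016,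
LemmSandvikWang2020 (arXiv:1910.11810) for the threshold-raising pattern; tree `abstractBasin_two_pow_6/8/9`. -/
theorem stub_abstractBasin36 : AbstractBasin (1 / 2 ^ 3) (1 / 24) := by
  sorry

/-- **Stub 3 — X, the asymptotic-freedom pin (tree statement `ColdPressurePincer.AFToColdPressure`, BY NAME; shared with the lines
`cold-pressure-pincer`, `doubling-bridge`, `floor-handshake`).** -/
theorem stub_afToColdPressure : AFToColdPressure := by
  sorry

/-- **Stub 4 — N, the residual of record on the non-simply-connected family (tree statement `ColdPressurePincer.IRnsc`, BY NAME).** -/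
theorem stub_irnsc : IRnsc := by
  sorry

/-! ## §3 Seams (PROVED; no sorry below this line) -/

/-- **Tolerance split**: seed at `θ` and basin `θ → ε` give the seed at `ε`. -/
theorem coldExitAt_of_seed_basin {θ ε : ℝ} (hS : ColdExitAt θ) (hB : BasinSC θ ε) : ColdExitAt ε := by
  intro G _ _ _ _ hG hsc
  letI : MeasurableSpace G := borel G
  haveI : BorelSpace G := ⟨rfl⟩
  intro r
  obtain ⟨β₁, hβ₁⟩ := hS G hG hsc r
  obtain ⟨β₂, hβ₂⟩ := hB G hG hsc r
  refine ⟨max β₁ β₂, fun β hβ => ?_⟩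
  exact hβ₂ β (le_trans (le_max_right _ _) hβ) (hβ₁ β (le_trans (le_max_left _ _) hβ))

/-- **The strengthening implies the model form**: Wilson's theory at `β ≥ 0` is an axis-symmetric trace-positive family with volume
bounds (`AspectBootstrap.axisSymmetric`, `tracePositive`, `volumeBounds`; `coldDefect_eq_boxDefect`). -/
theorem basinSC_of_abstract {θ ε : ℝ} (hA : AbstractBasin θ ε) : BasinSC θ ε := by
  intro G _ _ _ _ hG hsc
  letI : MeasurableSpace G := borel G
  haveI : BorelSpace G := ⟨rfl⟩
  intro r
  refine ⟨0, fun β hβ hθ => ?_⟩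
  obtain ⟨L, hL, hδ⟩ := hθ
  rw [coldDefect_eq_boxDefect] at hδ
  obtain ⟨L', hL', hδ'⟩ := hA _ (axisSymmetric r β) (tracePositive r hβ) (volumeBounds r hβ) L hL hδ
  exact ⟨L', hL', by rw [coldDefect_eq_boxDefect]; exact hδ'⟩

/-- Basins compose. -/
theorem basinSC_trans {θ η ε : ℝ} (h₁ : BasinSC θ η) (h₂ : BasinSC η ε) : BasinSC θ ε := by
  intro G _ _ _ _ hG hsc
  letI : MeasurableSpace G := borel G
  haveI : BorelSpace G := ⟨rfl⟩
  intro r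
  obtain ⟨β₁, hβ₁⟩ := h₁ G hG hsc r
  obtain ⟨β₂, hβ₂⟩ := h₂ G hG hsc r
  refine ⟨max β₁ β₂, fun β hβ hθ => ?_⟩
  exact hβ₂ β (le_trans (le_max_right _ _) hβ) (hβ₁ β (le_trans (le_max_left _ _) hβ) hθ)

/-- **PROVED (tree)**: the model basin from `2⁻⁹`, from the landed `abstractBasin_two_pow_9`. -/
theorem basinSC_two_pow_9 : BasinSC (1 / 2 ^ 9) epsStar :=
  basinSC_of_abstract abstractBasin_two_pow_9

/-- **PROVED (tree, rev 6)**: the model basin from `2⁻⁸`, from the landed `abstractBasin_two_pow_8_epsStar` (sharp extension `(8/3)³`). -/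
theorem basinSC_two_pow_8 : BasinSC (1 / 2 ^ 8) epsStar :=
  basinSC_of_abstract abstractBasin_two_pow_8_epsStar

/-- **The rev 4–6 rank-2 stub is CLOSED (tree, rev 7)**: `AbstractBasin (1/2^6) (1/2^8)` is `BasinRung.abstractBasin_two_pow_6` (p603750). -/
theorem abstractBasin64_closed : AbstractBasin (1 / 2 ^ 6) (1 / 2 ^ 8) := abstractBasin_two_pow_6

/-- **PROVED (tree, rev 7)**: the model basin from `2⁻⁶`. -/
theorem basinSC_two_pow_6 : BasinSC (1 / 2 ^ 6) epsStar :=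
  basinSC_of_abstract abstractBasin_two_pow_6_epsStar

/-- **PROVED (tree, rev 8)**: the model basin from `1/24` (`abstractBasin_24_epsStar`, p604479). -/
theorem basinSC_24 : BasinSC (1 / 24) epsStar :=
  basinSC_of_abstract abstractBasin_24_epsStar

/-! ## §6 The cut is an exact factorisation of the seed (crit-3 K-EQUIV, reproduced) and the registered composition -/

/-- **Model basin ⟸ deep seed, outright** (hypothesis `θ` unused): the model form of the basin is the seed in costume — provers must NOT
attack it model-specifically (crit-3 P3); the non-circular door is `AbstractBasin`. -/
theorem basinSC_of_coldExitAt {θ ε : ℝ} (hE : ColdExitAt ε) : BasinSC θ ε := by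
  intro G _ _ _ _ hG hsc
  letI : MeasurableSpace G := borel G
  haveI : BorelSpace G := ⟨rfl⟩
  intro r
  obtain ⟨β₁, hβ₁⟩ := hE G hG hsc r
  exact ⟨β₁, fun β hβ _ => hβ₁ β hβ⟩

/-- **`cut_iff_seed`**: `E(θ) ∧ Basin(θ → ε⋆) ↔ E(ε⋆)` for `θ ≥ ε⋆` — each half weaker in form, the conjunction equivalent (crit-3 K-EQUIV). -/
theorem cut_iff_seed {θ : ℝ} (hθ : epsStar ≤ θ) : (ColdExitAt θ ∧ BasinSC θ epsStar) ↔ ColdExitAt epsStar :=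
  ⟨fun h => coldExitAt_of_seed_basin h.1 h.2,
   fun h => ⟨coldExitAt_mono hθ h, basinSC_of_coldExitAt h⟩⟩

/-- Implication form: `E(θ) → Basin(θ → ε⋆) → X → N → IR`, for any tolerance `θ` (landed `IR_of_exitAt`). -/
theorem IR_of_seed_basin {θ : ℝ} (hS : ColdExitAt θ) (hB : BasinSC θ epsStar) (hX : AFToColdPressure) (hN : IRnsc) :
    Summit.QuantumFields.YangMills.Theses.BalabanLadder.IR :=
  IR_of_exitAt (coldExitAt_of_seed_basin hS hB) hX hN

/-- The direct form over the landed rungs: `AbstractBasin(1/8 → 1/24) → E(1/8) → X → N → IR` (`coldExitAt_of_abstractBasin`, `IR_of_exitAt24`). -/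
theorem IR_of_abstract (hA : AbstractBasin (1 / 2 ^ 3) (1 / 24)) (hS : ColdExitAt (1 / 2 ^ 3)) (hX : AFToColdPressure) (hN : IRnsc) :
    Summit.QuantumFields.YangMills.Theses.BalabanLadder.IR :=
  IR_of_exitAt24 (coldExitAt_of_abstractBasin hS hA) hX hN

/-- **`IR_of` — the registered composition (rev 7)**: `stub_abstractBasin36 → stub_seed8 → stub_afToColdPressure → stub_irnsc → IR`,
through `basinSC_of_abstract`, `basinSC_trans` and the PROVED rung `basinSC_24`. -/
theorem IR_of : AbstractBasin (1 / 2 ^ 3) (1 / 24) → ColdExitAt (1 / 2 ^ 3) → AFToColdPressure → IRnsc →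
    Summit.QuantumFields.YangMills.Theses.BalabanLadder.IR :=
  fun hA hS hX hN => IR_of_seed_basin hS (basinSC_trans (basinSC_of_abstract hA) basinSC_24) hX hN

/-- Closed form over the stubs (depends on `sorryAx` through the stubs only). -/
theorem IR_of_stubs : Summit.QuantumFields.YangMills.Theses.BalabanLadder.IR :=
  IR_of stub_abstractBasin36 stub_seed8 stub_afToColdPressure stub_irnsc

end Summit.QuantumFields.YangMills.Cruxes.IR.BasinTransfer

end
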